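import Mathlib
import Literature.MathematicalPhysics.QuantumFieldTheory.Balaban1983to89.B5Block118

/-!
# B5 (1.4)/(1.18)/(1.20)/(1.21) AT A CONSTANT ABELIAN BACKGROUND ("TORON TWINS"): the phase-twisted
# position-space operators `∂^ω`, `Δ_ω`, `∂^ω` on vector functions (covariant curl), `Q′^ω_k`, `Q^ω_k`

statement-level skeleton of published theorems with citation tags; proofs where landed; nothing here is a claim
about the Yang–Mills mass gap

Sources.  T. Bałaban, *Propagators and renormalization transformations for lattice gauge theories. I*,
Commun. Math. Phys. **95** (1984) 17–40 [Balaban1984PropagatorsI] ("B5"): (1.4) p. 18, (1.18)/(1.20) p. 20,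
(1.21) p. 21.  T. Bałaban, *Propagators for lattice gauge theories in a background field*, Commun. Math. Phys.
**99** (1985) 389–434 [Balaban1985BackgroundPropagators] ("B9"): (3.3)/(3.4) p. 391, (3.8)–(3.10) p. 392, (3.19)
p. 393, (3.23) p. 394 (text layer `paper:balaban1985-cmp99-background-propagators` pp. 390–394 read this session).

## What the papers print (verbatim)

[B9] p. 390–391: «Let us introduce covariant derivatives. For a matrix valued function λ defined at points of the
lattice we put (D^η_{U₀}λ)(b) = η⁻¹(R(U₀(b))λ(b₊) − λ(b₋)), or (D^η_{U₀,μ}λ)(x) = (D^η_{U₀}λ)(⟨x, x + ηe_μ⟩),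
μ = 1, …, d. (3.3)  For a function A defined at bonds of the lattice we put (D^η_{U₀}A)(p) = η⁻¹(A(x,y) +
R(U₀(x,y))A(y,z) + R(U₀(x,w))A(z,w) + A(w,x)) (3.4) for a plaquette p = ⟨x, y, z, w⟩, and if p = p_{μν}(x) …
then we have (D^η_{U₀}A)(p_{μν}(x)) = (D_{U₀,μ}A_ν)(x) − (D_{U₀,ν}A_μ)(x).» (here `R(U)X = UXU⁻¹`);
p. 392: «The quadratic terms in the expansion (3.7) define the basic operator generalizing the operator ∂*∂ in the
Abelian case. We denote it by Δ^η(U), or simply by Δ.»; p. 393 (3.19): «(Q′(U)λ)(y) = Σ_{x∈B(y)} L^{−d}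
R(U(Γ_{y,x}))λ(x)»; p. 394 (3.23): «Δ_U = D*_U D_U = Σ_μ D*_μ D_μ».
[B5] p. 18 (1.4): «A^λ_b = A_b − (∂λ)(b), (∂λ)(b) = ε⁻¹(λ(b₊) − λ(b₋))»; p. 20 (1.18): «(Q_kA)_b =
Σ_{x∈B^k(b₋)} η^{d+1}A([x, x(b)])», (1.20): «(Q_kA^λ)_b = (Q_kA)_b − (Σ_{x∈B^k(b₊)} η^dλ(x) − Σ_{x∈B^k(b₋)}
η^dλ(x)) … or denoting (Q′_kλ)(y) = Σ_{x∈B^k(y)} η^dλ(x), we have Q_kA^λ = Q_kA − ∂Q′_kλ»; p. 21 (1.21):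
«⟨∂A, ∂A⟩ = ½ Σ_{x∈T_η,μ,ν} η^d|F_{μν}(x)|² = … = Σ_μ ⟨A_μ, ΔA_μ⟩ − ⟨∂*A, ∂*A⟩».

## What this module types (the "toron twins", requested by the `ym3-torus` cell, exit (α)(a) D1)

At a CONSTANT ABELIAN background — after a global gauge `U₀(x, x + ηe_ν) = g_ν` for all `x`, the `g_ν` in one
maximal torus — the adjoint action `R(g_ν)` on a charged sector of the complexified Lie algebra is multiplication by a
unit complex number `ω_ν` (`ω_ν = e^{±2iθ_ν}` for SU(2), `g_ν = e^{iθ_νσ₃}`).  On that sector every operator of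
[B9] §A built from the covariant translation `λ ↦ R(U₀(⟨x,x+ηe_ν⟩))λ(x + ηe_ν)` becomes the corresponding
operator of [B5] with the lattice translation `S_ν` REPLACED BY `ω_ν S_ν`.  This module types these operators in the
letters of the flat files (`B5Action121`, `B5Block118`), for an arbitrary phase vector `ω : Fin d → ℂ` (the intended
use is `‖ω_ν‖ = 1`; no statement here needs it), and proves for each the `ω = 1` RECOVERY LEMMA (`…_one`: the
twin at `ω = 1` IS the flat letter) together with the position-space identities the flat files certify:
* §1 scalar calculus: `sdiffTw N c ω ν = c(ω_ν S_ν − 1)` = (3.3) `D_{U₀,ν}`; commutation of the twisted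
  differences and of a difference with an adjoint one (flatness of a constant abelian background); `LapSTw = Σ_ν
  (∂^ω_ν)^*∂^ω_ν` = (3.23) `Δ_U = Σ_μ D*_μD_μ`; `GradOpTw` (= `D` on scalar functions), `divSTw` (= (3.8) `D*`).
* §2 vector fields: `fdiffTw` (componentwise), `pdTw`, `FsTw` = (3.4) `(DA)_{μν} = D_μA_ν − D_νA_μ`, `gaugeTTw`
  («A^λ = A − Dλ», [B9] p. 393), gauge invariance of `FsTw` (because `D_μD_ν = D_νD_μ` at a flat background),
  `LapVTw`, `CurlOpTw`, and **`curlTw_adjoint_curlTw`**: `(CurlOpTw)ᴴ CurlOpTw = 2·(LapVTw − GradOpTw GradOpTwᴴ)` —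
  the twisted (1.21) «Δ = ∂*∂ + ∂∂*» ([B9] (3.10) at `Δ′ = 0`, which is the case of a flat background), proved along
  the flat file's chain (1.21) equality by equality; `LapTw n M ω` = the twin of `B5Prop11Lower.Lap`.
* §3 block averages on `T_η = Tor (fine n M)` over the unit lattice `Tor M`: `QsOpTw` = (3.19) with
  `R(U(Γ_{y,x})) = ω^j := Π_ν ω_ν^{j_ν}` for `x = ny + j` (transport from the block's base corner), `lineSumTw`
  (transport `ω_μ^t` along the straight contour `[x, x + e_μ]`), `QvOpTw` = the linear part `Q(U₀)` of the averaging
  (3.13)–(3.15) on the charged sector in the same reading, their `mulVec` formulas, and the twisted (1.20):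
  **`QvOpTw_gaugeTTw_eq`: `Q^ω_k(A − ∂^ωλ) = Q^ω_kA − ∂^{ω^n}Q′^ω_kλ`** (the coarse bond `⟨y, y+e_μ⟩` carries the
  holonomy `ω_μ^n` of `n` fine steps).

DECLARED READING / HONEST SCOPE.  (R1) The identification of a `ym3-torus` member's operators at a constant abelian
`U₀` with these letters (sector decomposition, choice of contours `Γ_{y,x}` in [B7] (52)–(53)) is NOT made here; we
type the straight-contour, corner-based reading.  For `‖ω_ν‖ = 1` a different base point inside the block multiplies
`QsOpTw`/`QvOpTw` by one global unit phase, which cancels in every `Q*…Q` product (so in `PcTTw`, `DeltaATw` of the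
companion file `B5ToronMomentum161`).  (R2) Fields are complex scalars (one charged sector); nothing non-abelian is
typed.  (R3) 0 `sorry`, 0 `instance`, 0 `notation`; definitions + kernel-checked identities only; NOT summit
progress (rung R3 of the `ym3-torus` ladder is YM₃ on T³ — not d = 4, not a mass gap, not Clay).
-/

open scoped BigOperators Matrix ComplexConjugate ComplexOrder Matrix.Norms.L2Operator
open Finset Complex

namespace Literature.MathematicalPhysics.QuantumFieldTheory.Balaban1983to89.B5ToronOperators118

open Literature.MathematicalPhysics.QuantumFieldTheory.Balaban1983to89.B5Prop11Plancherel
open Literature.MathematicalPhysics.QuantumFieldTheory.Balaban1983to89.B5Prop11Lower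
open Literature.MathematicalPhysics.QuantumFieldTheory.Balaban1983to89.B5Action121
open Literature.MathematicalPhysics.QuantumFieldTheory.Balaban1983to89.B5Block118

noncomputable section

/-! ## §1 Scalar twisted lattice calculus: `∂^ω_ν`, its adjoint, `Δ_ω`, `∂^ω` and `∂^{ω*}` -/

section Scalar

variable {d : ℕ} (N : Fin d → ℕ) [hN : ∀ μ, NeZero (N μ)]

/-- the twisted forward difference `(∂^ω_ν f)(x) = c (ω_ν f(x + e_ν) − f(x))` with lattice factor `c = η⁻¹` and a
constant phase `ω_ν`: [B9] (3.3) `(D_{U₀,ν}λ)(x) = η⁻¹(R(U₀(⟨x,x+ηe_ν⟩))λ(x+ηe_ν) − λ(x))` at a constant abelian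
`U₀` on a charged sector (`R(U₀(b)) = ω_ν`); at `ω = 1` it is (1.4) `∂_ν` (`sdiffTw_one`).
[cite: Balaban1985BackgroundPropagators, (3.3) p.391; Balaban1984PropagatorsI, (1.4) p.18] -/
def sdiffTw (c : ℂ) (ω : Fin d → ℂ) (ν : Fin d) : Matrix (Tor N) (Tor N) ℂ :=
  c • (ω ν • shiftS N ν - 1)

omit hN in
/-- RECOVERY: `∂^1_ν = ∂_ν`. [cite: Balaban1984PropagatorsI, (1.4) p.18] -/
theorem sdiffTw_one (c : ℂ) (ν : Fin d) : sdiffTw N c 1 ν = sdiff N c ν := by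
  simp only [sdiffTw, Pi.one_apply, one_smul]
  rfl

/-- `(∂^ω_ν f)(x) = c (ω_ν f(x + e_ν) − f(x))`. [cite: Balaban1985BackgroundPropagators, (3.3) p.391] -/
theorem sdiffTw_mulVec (c : ℂ) (ω : Fin d → ℂ) (ν : Fin d) (f : Tor N → ℂ) (x : Tor N) :
    (sdiffTw N c ω ν *ᵥ f) x = c * (ω ν * f (x + unitVec N ν) - f x) := by
  simp only [sdiffTw, Matrix.smul_mulVec, Matrix.sub_mulVec, Matrix.one_mulVec, Pi.smul_apply,
    Pi.sub_apply, shiftS_mulVec, smul_eq_mul]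

/-- the adjoint `((∂^ω_ν)^* f)(x) = \bar c (\bar ω_ν f(x − e_ν) − f(x))` ([B9] (3.8): `D*` transports back with
`R(U(x, x − ηe_μ))`). [cite: Balaban1985BackgroundPropagators, (3.8) p.392] -/
theorem sdiffTw_conjTranspose_mulVec (c : ℂ) (ω : Fin d → ℂ) (ν : Fin d) (f : Tor N → ℂ) (x : Tor N) :
    ((sdiffTw N c ω ν)ᴴ *ᵥ f) x = conj c * (conj (ω ν) * f (x - unitVec N ν) - f x) := by
  simp only [sdiffTw, Matrix.conjTranspose_smul, Matrix.conjTranspose_sub, Matrix.conjTranspose_one,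
    Matrix.smul_mulVec, Matrix.sub_mulVec, Matrix.one_mulVec, Pi.smul_apply, Pi.sub_apply,
    shiftS_conjTranspose_mulVec, smul_eq_mul, Complex.star_def]

/-- twisted forward differences commute: `∂^ω_μ ∂^ω_ν = ∂^ω_ν ∂^ω_μ` (a constant abelian background is FLAT: the
plaquette holonomy `ω_μω_νω_μ⁻¹ω_ν⁻¹` is `1`). [cite: Balaban1985BackgroundPropagators, (3.3)-(3.4) p.391] -/
theorem sdiffTw_sdiffTw_comm (c : ℂ) (ω : Fin d → ℂ) (μ ν : Fin d) (f : Tor N → ℂ) :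
    sdiffTw N c ω μ *ᵥ (sdiffTw N c ω ν *ᵥ f) = sdiffTw N c ω ν *ᵥ (sdiffTw N c ω μ *ᵥ f) := by
  funext x
  simp only [sdiffTw_mulVec]
  rw [add_right_comm x (unitVec N μ) (unitVec N ν)]
  ring

/-- `(∂^ω_μ)^* ∂^ω_ν = ∂^ω_ν (∂^ω_μ)^*` (twisted translations commute with the adjoints of the others).
[cite: Balaban1985BackgroundPropagators, (3.3) p.391, (3.8) p.392] -/
theorem sdiffTwH_sdiffTw_comm (c : ℂ) (ω : Fin d → ℂ) (μ ν : Fin d) (f : Tor N → ℂ) :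
    (sdiffTw N c ω μ)ᴴ *ᵥ (sdiffTw N c ω ν *ᵥ f) = sdiffTw N c ω ν *ᵥ ((sdiffTw N c ω μ)ᴴ *ᵥ f) := by
  funext x
  simp only [sdiffTw_mulVec, sdiffTw_conjTranspose_mulVec]
  rw [sub_add_eq_add_sub x (unitVec N μ) (unitVec N ν)]
  ring

/-- the twisted scalar Laplace operator `Δ_ω = Σ_ν (∂^ω_ν)^* ∂^ω_ν`: [B9] (3.23) «Δ_U = D*_U D_U = Σ_μ D*_μ D_μ» at
a constant abelian background; at `ω = 1` the `Δ` of (1.21) (`LapSTw_one`).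
[cite: Balaban1985BackgroundPropagators, (3.23) p.394; Balaban1984PropagatorsI, (1.21) p.21] -/
def LapSTw (c : ℂ) (ω : Fin d → ℂ) : Matrix (Tor N) (Tor N) ℂ :=
  ∑ ν, (sdiffTw N c ω ν)ᴴ * sdiffTw N c ω ν

/-- RECOVERY: `Δ_1 = Δ`. [cite: Balaban1984PropagatorsI, (1.21) p.21] -/
theorem LapSTw_one (c : ℂ) : LapSTw N c 1 = LapS N c := by
  simp only [LapSTw, LapS, sdiffTw_one]

/-- `(Δ_ω f)(x) = Σ_ν |c|² ((1 + |ω_ν|²) f(x) − ω_ν f(x + e_ν) − \bar ω_ν f(x − e_ν))` (for a unit twist the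
diagonal coefficient is the flat `2`). [cite: Balaban1985BackgroundPropagators, (3.23) p.394] -/
theorem LapSTw_mulVec (c : ℂ) (ω : Fin d → ℂ) (f : Tor N → ℂ) (x : Tor N) :
    (LapSTw N c ω *ᵥ f) x
      = ∑ ν, conj c * c * ((1 + conj (ω ν) * ω ν) * f x - ω ν * f (x + unitVec N ν)
          - conj (ω ν) * f (x - unitVec N ν)) := by
  simp only [LapSTw, Matrix.sum_mulVec, Finset.sum_apply, ← Matrix.mulVec_mulVec,
    sdiffTw_conjTranspose_mulVec, sdiffTw_mulVec, sub_add_cancel]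
  refine Finset.sum_congr rfl fun ν _ => ?_
  ring

/-- the twisted gradient `∂^ω` from scalar to vector functions: `(∂^ωλ)(⟨x, x+e_ν⟩) = (∂^ω_νλ)(x)` ([B9] (3.3), the
`D` of «A^λ = A − Dλ» p. 393); at `ω = 1` the `∂` of (1.4) (`GradOpTw_one`).
[cite: Balaban1985BackgroundPropagators, (3.3) p.391; Balaban1984PropagatorsI, (1.4) p.18] -/
def GradOpTw (c : ℂ) (ω : Fin d → ℂ) : Matrix (Tor N × Fin d) (Tor N) ℂ :=
  fun i y => sdiffTw N c ω i.2 i.1 y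

omit hN in
/-- RECOVERY: `∂^1 = ∂` (`B5Action121.GradOp`). [cite: Balaban1984PropagatorsI, (1.4) p.18] -/
theorem GradOpTw_one (c : ℂ) : GradOpTw N c 1 = GradOp N c := by
  ext i y
  simp only [GradOpTw, GradOp, sdiffTw_one]

/-- `(∂^ωλ)_ν(x) = (∂^ω_ν λ)(x)`. [cite: Balaban1985BackgroundPropagators, (3.3) p.391] -/
theorem GradOpTw_mulVec (c : ℂ) (ω : Fin d → ℂ) (l : Tor N → ℂ) (x : Tor N) (ν : Fin d) :
    (GradOpTw N c ω *ᵥ l) (x, ν) = (sdiffTw N c ω ν *ᵥ l) x := rfl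

/-- `(∂^ω)^*∂^ω = Δ_ω` on scalar functions ([B9] (3.23) «Δ_U = D*_U D_U»).
[cite: Balaban1985BackgroundPropagators, (3.23) p.394] -/
theorem GradOpTw_conjTranspose_mul_GradOpTw (c : ℂ) (ω : Fin d → ℂ) :
    (GradOpTw N c ω)ᴴ * GradOpTw N c ω = LapSTw N c ω := by
  ext x y
  simp only [Matrix.mul_apply, Matrix.conjTranspose_apply, GradOpTw, LapSTw, Matrix.sum_apply,
    Fintype.sum_prod_type]
  rw [Finset.sum_comm]

/-- the twisted divergence `(∂^ω)^*A = Σ_μ (∂^ω_μ)^* A_μ` ([B9] (3.8) «(D*A)(x) = Σ_μ (D*_μ A_μ)(x)»).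
[cite: Balaban1985BackgroundPropagators, (3.8) p.392; Balaban1984PropagatorsI, (1.21) p.21] -/
def divSTw (c : ℂ) (ω : Fin d → ℂ) (A : Tor N × Fin d → ℂ) : Tor N → ℂ :=
  ∑ μ, (sdiffTw N c ω μ)ᴴ *ᵥ comp N A μ

/-- RECOVERY: `(∂^1)^* = ∂*` (`B5Action121.divS`). [cite: Balaban1984PropagatorsI, (1.21) p.21] -/
theorem divSTw_one (c : ℂ) (A : Tor N × Fin d → ℂ) : divSTw N c 1 A = divS N c A := by
  simp only [divSTw, divS, sdiffTw_one]

/-- `((∂^ω)^*A)(x) = Σ_μ \bar c (\bar ω_μ A_μ(x − e_μ) − A_μ(x))`. [cite: Balaban1985BackgroundPropagators, (3.8) p.392] -/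
theorem divSTw_apply (c : ℂ) (ω : Fin d → ℂ) (A : Tor N × Fin d → ℂ) (x : Tor N) :
    divSTw N c ω A x = ∑ μ, conj c * (conj (ω μ) * A (x - unitVec N μ, μ) - A (x, μ)) := by
  simp only [divSTw, Finset.sum_apply, sdiffTw_conjTranspose_mulVec, comp]

/-- `(∂^ω)^* = (∂^ω)ᴴ`: the twisted divergence is the adjoint of the twisted gradient.
[cite: Balaban1985BackgroundPropagators, (3.8) p.392] -/
theorem GradOpTw_conjTranspose_mulVec (c : ℂ) (ω : Fin d → ℂ) (A : Tor N × Fin d → ℂ) (y : Tor N) :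
    ((GradOpTw N c ω)ᴴ *ᵥ A) y = divSTw N c ω A y := by
  simp only [Matrix.mulVec, dotProduct, Matrix.conjTranspose_apply, GradOpTw, divSTw,
    Finset.sum_apply, Fintype.sum_prod_type, comp]
  rw [Finset.sum_comm]

/-- `(∂^ω)ᴴ A = (∂^ω)^*A` as functions. [cite: Balaban1985BackgroundPropagators, (3.8) p.392] -/
theorem GradOpTw_conjTranspose_mulVec_eq (c : ℂ) (ω : Fin d → ℂ) (A : Tor N × Fin d → ℂ) :
    (GradOpTw N c ω)ᴴ *ᵥ A = divSTw N c ω A :=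
  funext fun y => GradOpTw_conjTranspose_mulVec N c ω A y

end Scalar

/-! ## §2 Vector fields: `∇^ω_ν`, the covariant plaquette field (3.4), gauge transformations, `Σ_ν(∇^ω_ν)^*∇^ω_ν`,
the covariant curl and the twisted (1.21) -/

section Vector

variable {d : ℕ} (N : Fin d → ℕ) [hN : ∀ μ, NeZero (N μ)]

/-- the twisted forward difference on vector functions, componentwise: `(∇^ω_ν A)_κ(x) = c(ω_ν A_κ(x+e_ν) − A_κ(x))`
(the twin of `B5Prop11Plancherel.fdiff`). [cite: Balaban1985BackgroundPropagators, (3.3) p.391; Balaban1984PropagatorsI, (1.31) p.23] -/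
def fdiffTw (c : ℂ) (ω : Fin d → ℂ) (ν : Fin d) : Matrix (Tor N × Fin d) (Tor N × Fin d) ℂ :=
  c • (ω ν • shiftM N ν - 1)

omit hN in
/-- RECOVERY: `∇^1_ν = ∇_ν` (`B5Prop11Plancherel.fdiff`). [cite: Balaban1984PropagatorsI, (1.31) p.23] -/
theorem fdiffTw_one (c : ℂ) (ν : Fin d) : fdiffTw N c 1 ν = fdiff N c ν := by
  simp only [fdiffTw, fdiff, Pi.one_apply, one_smul]

/-- `(∇^ω_ν A)_κ = ∂^ω_ν A_κ`. [cite: Balaban1985BackgroundPropagators, (3.3) p.391] -/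
theorem fdiffTw_mulVec_apply (c : ℂ) (ω : Fin d → ℂ) (ν : Fin d) (A : Tor N × Fin d → ℂ) (x : Tor N)
    (κ : Fin d) : (fdiffTw N c ω ν *ᵥ A) (x, κ) = (sdiffTw N c ω ν *ᵥ comp N A κ) x := by
  rw [sdiffTw_mulVec]
  simp only [fdiffTw, Matrix.smul_mulVec, Matrix.sub_mulVec, Matrix.one_mulVec, Pi.smul_apply,
    Pi.sub_apply, shiftM_mulVec, smul_eq_mul, comp]

/-- `(∂^ω_μ A_ν)(x)` ([B9] (3.4): `(D_{U₀,μ}A_ν)(x)`). [cite: Balaban1985BackgroundPropagators, (3.4) p.391] -/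
def pdTw (c : ℂ) (ω : Fin d → ℂ) (A : Tor N × Fin d → ℂ) (μ ν : Fin d) : Tor N → ℂ :=
  sdiffTw N c ω μ *ᵥ comp N A ν

/-- RECOVERY: `pdTw … 1 = pd`. [cite: Balaban1984PropagatorsI, (1.2) p.18] -/
theorem pdTw_one (c : ℂ) (A : Tor N × Fin d → ℂ) (μ ν : Fin d) : pdTw N c 1 A μ ν = pd N c A μ ν := by
  simp only [pdTw, pd, sdiffTw_one]

/-- [B9] (3.4): the covariant plaquette field `(DA)_{μν}(x) = (D_μA_ν)(x) − (D_νA_μ)(x)` at a constant abelian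
background (the twin of (1.2) `F_{μν}`). [cite: Balaban1985BackgroundPropagators, (3.4) p.391] -/
def FsTw (c : ℂ) (ω : Fin d → ℂ) (A : Tor N × Fin d → ℂ) (μ ν : Fin d) : Tor N → ℂ :=
  fun x => pdTw N c ω A μ ν x - pdTw N c ω A ν μ x

/-- RECOVERY: `FsTw … 1 = Fs` ((1.2)). [cite: Balaban1984PropagatorsI, (1.2) p.18] -/
theorem FsTw_one (c : ℂ) (A : Tor N × Fin d → ℂ) (μ ν : Fin d) : FsTw N c 1 A μ ν = Fs N c A μ ν := by
  funext x
  simp only [FsTw, Fs, pdTw_one]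

/-- (3.4) unfolded: `(DA)_{μν}(x) = c(ω_μ A_ν(x+e_μ) − A_ν(x) − ω_ν A_μ(x+e_ν) + A_μ(x))` — «η⁻¹(A(x,y) +
R(U₀(x,y))A(y,z) + R(U₀(x,w))A(z,w) + A(w,x))» with `A(z,w) = −A_μ(x+e_ν)`, `A(w,x) = −A_ν(x)`.
[cite: Balaban1985BackgroundPropagators, (3.4) p.391] -/
theorem FsTw_apply (c : ℂ) (ω : Fin d → ℂ) (A : Tor N × Fin d → ℂ) (μ ν : Fin d) (x : Tor N) :
    FsTw N c ω A μ ν x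
      = c * (A (x, μ) + ω μ * A (x + unitVec N μ, ν) - ω ν * A (x + unitVec N ν, μ) - A (x, ν)) := by
  simp only [FsTw, pdTw, sdiffTw_mulVec, comp]
  ring

/-- `(DA)_{μν} = −(DA)_{νμ}` («(D^η_{U₀}A)(−p) = −(D^η_{U₀}A)(p)»). [cite: Balaban1985BackgroundPropagators, (3.5) p.391] -/
theorem FsTw_antisymm (c : ℂ) (ω : Fin d → ℂ) (A : Tor N × Fin d → ℂ) (μ ν : Fin d) (x : Tor N) :
    FsTw N c ω A μ ν x = -FsTw N c ω A ν μ x := by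
  simp only [FsTw]
  ring

/-- `(DA)_{μμ} = 0`. [cite: Balaban1985BackgroundPropagators, (3.4)-(3.5) p.391] -/
theorem FsTw_self (c : ℂ) (ω : Fin d → ℂ) (A : Tor N × Fin d → ℂ) (μ : Fin d) (x : Tor N) :
    FsTw N c ω A μ μ x = 0 := by
  simp only [FsTw, sub_self]

/-- the linearised gauge transformation at the background, «A^λ = A − Dλ» ([B9] p. 393, before (3.17)); the twin of
(1.4). [cite: Balaban1985BackgroundPropagators, (3.17) p.393; Balaban1984PropagatorsI, (1.4) p.18] -/
def gaugeTTw (c : ℂ) (ω : Fin d → ℂ) (A : Tor N × Fin d → ℂ) (l : Tor N → ℂ) : Tor N × Fin d → ℂ :=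
  A - GradOpTw N c ω *ᵥ l

/-- RECOVERY: `gaugeTTw … 1 = gaugeT` ((1.4)). [cite: Balaban1984PropagatorsI, (1.4) p.18] -/
theorem gaugeTTw_one (c : ℂ) (A : Tor N × Fin d → ℂ) (l : Tor N → ℂ) :
    gaugeTTw N c 1 A l = gaugeT N c A l := by
  simp only [gaugeTTw, gaugeT, GradOpTw_one]

/-- the covariant plaquette field is invariant under `A ↦ A − Dλ` at a flat background (`D_μD_νλ = D_νD_μλ`).
[cite: Balaban1985BackgroundPropagators, (3.4) p.391, (3.17) p.393] -/
theorem FsTw_gaugeTTw (c : ℂ) (ω : Fin d → ℂ) (A : Tor N × Fin d → ℂ) (l : Tor N → ℂ) (μ ν : Fin d)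
    (x : Tor N) : FsTw N c ω (gaugeTTw N c ω A l) μ ν x = FsTw N c ω A μ ν x := by
  simp only [FsTw_apply, gaugeTTw, Pi.sub_apply, GradOpTw_mulVec, sdiffTw_mulVec]
  rw [add_right_comm x (unitVec N ν) (unitVec N μ)]
  ring

/-- `Σ_ν (∇^ω_ν)^* ∇^ω_ν` on vector fields (the twin of `B5Action121.LapV`; `Δ_U` of (3.23) componentwise).
[cite: Balaban1985BackgroundPropagators, (3.23) p.394; Balaban1984PropagatorsI, (1.21) p.21] -/
def LapVTw (c : ℂ) (ω : Fin d → ℂ) : Matrix (Tor N × Fin d) (Tor N × Fin d) ℂ :=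
  ∑ ν, (fdiffTw N c ω ν)ᴴ * fdiffTw N c ω ν

/-- RECOVERY: `LapVTw … 1 = LapV`. [cite: Balaban1984PropagatorsI, (1.21) p.21] -/
theorem LapVTw_one (c : ℂ) : LapVTw N c 1 = LapV N c := by
  simp only [LapVTw, LapV, fdiffTw_one]

/-- `Σ_i |(∇^ω_ν A)_i|² = Σ_κ Σ_x |(∂^ω_ν A_κ)(x)|²` (the vector `D_ν` acts componentwise).
[cite: Balaban1985BackgroundPropagators, (3.3) p.391, (3.23) p.394] -/
theorem nsq_fdiffTw_mulVec (c : ℂ) (ω : Fin d → ℂ) (ν : Fin d) (A : Tor N × Fin d → ℂ) :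
    nsq (fdiffTw N c ω ν *ᵥ A) = ∑ κ, nsq (sdiffTw N c ω ν *ᵥ comp N A κ) := by
  rw [nsq, Fintype.sum_prod_type, Finset.sum_comm]
  refine Finset.sum_congr rfl fun κ _ => Finset.sum_congr rfl fun x _ => ?_
  rw [fdiffTw_mulVec_apply]

/-- `⟨A, Σ_ν (∇^ω_ν)^*∇^ω_ν A⟩ = Σ_κ ⟨A_κ, Δ_ω A_κ⟩`: the vector operator is the scalar `Δ_ω` on each component.
[cite: Balaban1985BackgroundPropagators, (3.23) p.394] -/
theorem form_LapVTw (c : ℂ) (ω : Fin d → ℂ) (A : Tor N × Fin d → ℂ) :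
    star A ⬝ᵥ (LapVTw N c ω *ᵥ A) = ∑ κ, star (comp N A κ) ⬝ᵥ (LapSTw N c ω *ᵥ comp N A κ) := by
  rw [LapVTw, Matrix.sum_mulVec, dotProduct_sum]
  simp_rw [form_gram, nsq_fdiffTw_mulVec, Complex.ofReal_sum]
  rw [Finset.sum_comm]
  refine Finset.sum_congr rfl fun κ _ => ?_
  rw [LapSTw, Matrix.sum_mulVec, dotProduct_sum]
  exact Finset.sum_congr rfl fun ν _ => (form_gram _ _).symm

/-- `⟨∂^ωf, ∂^ωf⟩ = ⟨f, Δ_ω f⟩` for a scalar function. [cite: Balaban1985BackgroundPropagators, (3.23) p.394] -/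
theorem form_gradTw_eq_form_LapSTw (c : ℂ) (ω : Fin d → ℂ) (f : Tor N → ℂ) :
    star (GradOpTw N c ω *ᵥ f) ⬝ᵥ (GradOpTw N c ω *ᵥ f) = star f ⬝ᵥ (LapSTw N c ω *ᵥ f) := by
  rw [← form_gram_rect, GradOpTw_conjTranspose_mul_GradOpTw]

/-- `⟨A, ∂^ω(∂^ω)^* A⟩ = ⟨(∂^ω)^*A, (∂^ω)^*A⟩` (`D*` is the adjoint of `D`, (3.8)).
[cite: Balaban1985BackgroundPropagators, (3.8) p.392] -/
theorem form_GradGradHTw (c : ℂ) (ω : Fin d → ℂ) (A : Tor N × Fin d → ℂ) :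
    star A ⬝ᵥ ((GradOpTw N c ω * (GradOpTw N c ω)ᴴ) *ᵥ A)
      = star (divSTw N c ω A) ⬝ᵥ divSTw N c ω A := by
  have h : GradOpTw N c ω * (GradOpTw N c ω)ᴴ = ((GradOpTw N c ω)ᴴ)ᴴ * (GradOpTw N c ω)ᴴ := by
    rw [Matrix.conjTranspose_conjTranspose]
  rw [h, form_gram_rect, GradOpTw_conjTranspose_mulVec_eq]

/-- the twisted (1.21), first equality: `½ Σ_{x,μ,ν}|(DA)_{μν}(x)|² = Σ_{x,μ,ν}|(D_μA_ν)(x)|² −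
Σ_{x,μ,ν} \overline{(D_μA_ν)(x)}(D_νA_μ)(x)`. [cite: Balaban1984PropagatorsI, (1.21) p.21; Balaban1985BackgroundPropagators, (3.10) p.392] -/
theorem half_sum_FsTw_sq_eq (c : ℂ) (ω : Fin d → ℂ) (A : Tor N × Fin d → ℂ) :
    ((((1 / 2 : ℝ) * ∑ x, ∑ μ, ∑ ν, ‖FsTw N c ω A μ ν x‖ ^ 2 : ℝ)) : ℂ)
      = ((∑ x, ∑ μ, ∑ ν, ‖pdTw N c ω A μ ν x‖ ^ 2 : ℝ) : ℂ)
        - ∑ x, ∑ μ, ∑ ν, conj (pdTw N c ω A μ ν x) * pdTw N c ω A ν μ x := by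
  have hL : (∑ x, ∑ μ, ∑ ν, ‖FsTw N c ω A μ ν x‖ ^ 2 : ℝ)
      = ∑ μ, ∑ ν, nsq (pdTw N c ω A μ ν - pdTw N c ω A ν μ) := by
    rw [sum3_comm]; rfl
  have hR : (∑ x, ∑ μ, ∑ ν, ‖pdTw N c ω A μ ν x‖ ^ 2 : ℝ) = ∑ μ, ∑ ν, nsq (pdTw N c ω A μ ν) := by
    rw [sum3_comm]; rfl
  have hX : (∑ x, ∑ μ, ∑ ν, conj (pdTw N c ω A μ ν x) * pdTw N c ω A ν μ x)
      = ∑ μ, ∑ ν, star (pdTw N c ω A μ ν) ⬝ᵥ pdTw N c ω A ν μ := by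
    rw [sum3_comm]; rfl
  rw [hL, hR, hX]
  push_cast
  simp_rw [← star_dotProduct_self, star_sub, sub_dotProduct, dotProduct_sub]
  have h1 : ∑ μ, ∑ ν, star (pdTw N c ω A ν μ) ⬝ᵥ pdTw N c ω A ν μ
      = ∑ μ, ∑ ν, star (pdTw N c ω A μ ν) ⬝ᵥ pdTw N c ω A μ ν := Finset.sum_comm
  have h2 : ∑ μ, ∑ ν, star (pdTw N c ω A ν μ) ⬝ᵥ pdTw N c ω A μ ν
      = ∑ μ, ∑ ν, star (pdTw N c ω A μ ν) ⬝ᵥ pdTw N c ω A ν μ := Finset.sum_comm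
  simp only [Finset.sum_sub_distrib, h1, h2]
  ring

/-- the twisted (1.21), cross term: `Σ_{x,μ,ν} \overline{(D_μA_ν)(x)}(D_νA_μ)(x) = Σ_x |((D)^*A)(x)|²` (by
`D_μ^*D_ν = D_νD_μ^*` at a flat background). [cite: Balaban1984PropagatorsI, (1.21) p.21; Balaban1985BackgroundPropagators, (3.10) p.392] -/
theorem crossTw_eq_nsq_divSTw (c : ℂ) (ω : Fin d → ℂ) (A : Tor N × Fin d → ℂ) :
    (∑ x, ∑ μ, ∑ ν, conj (pdTw N c ω A μ ν x) * pdTw N c ω A ν μ x)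
      = ((∑ x, ‖divSTw N c ω A x‖ ^ 2 : ℝ) : ℂ) := by
  have hX : (∑ x, ∑ μ, ∑ ν, conj (pdTw N c ω A μ ν x) * pdTw N c ω A ν μ x)
      = ∑ μ, ∑ ν, star (pdTw N c ω A μ ν) ⬝ᵥ pdTw N c ω A ν μ := by
    rw [sum3_comm]; rfl
  have hterm : ∀ μ ν, star (pdTw N c ω A μ ν) ⬝ᵥ pdTw N c ω A ν μ
      = star ((sdiffTw N c ω ν)ᴴ *ᵥ comp N A ν) ⬝ᵥ ((sdiffTw N c ω μ)ᴴ *ᵥ comp N A μ) := by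
    intro μ ν
    simp only [pdTw]
    rw [star_mulVec_dotProduct, sdiffTwH_sdiffTw_comm,
      dotProduct_mulVec_eq_star_conjTranspose_mulVec]
  have hD : ((∑ x, ‖divSTw N c ω A x‖ ^ 2 : ℝ) : ℂ) = star (divSTw N c ω A) ⬝ᵥ divSTw N c ω A := by
    rw [star_dotProduct_self]; rfl
  rw [hX, hD]
  simp_rw [hterm]
  rw [divSTw, star_sum, dotProduct_sum]
  refine Finset.sum_congr rfl fun μ _ => ?_
  rw [sum_dotProduct]

/-- the twisted (1.21), square term: `Σ_{x,μ,ν}|(D_μA_ν)(x)|² = Σ_ν ⟨D A_ν, D A_ν⟩`.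
[cite: Balaban1984PropagatorsI, (1.21) p.21] -/
theorem sum_sq_pdTw_eq_sum_form_gradTw (c : ℂ) (ω : Fin d → ℂ) (A : Tor N × Fin d → ℂ) :
    ((∑ x, ∑ μ, ∑ ν, ‖pdTw N c ω A μ ν x‖ ^ 2 : ℝ) : ℂ)
      = ∑ ν, star (GradOpTw N c ω *ᵥ comp N A ν) ⬝ᵥ (GradOpTw N c ω *ᵥ comp N A ν) := by
  have hR : (∑ x, ∑ μ, ∑ ν, ‖pdTw N c ω A μ ν x‖ ^ 2 : ℝ) = ∑ μ, ∑ ν, nsq (pdTw N c ω A μ ν) := by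
    rw [sum3_comm]; rfl
  rw [hR, Finset.sum_comm]
  push_cast
  refine Finset.sum_congr rfl fun ν _ => ?_
  rw [star_dotProduct_self, nsq, Fintype.sum_prod_type, Finset.sum_comm]
  push_cast
  refine Finset.sum_congr rfl fun κ _ => ?_
  rw [nsq]
  push_cast
  rfl

/-- **the twisted (1.21)**: `½ Σ_{x,μ,ν}|(DA)_{μν}(x)|² = Σ_μ ⟨A_μ, Δ_ω A_μ⟩ − ⟨D^*A, D^*A⟩` — [B9] (3.10)
`⟨A, ΔA⟩ = ⟨DA, DA⟩ + ⟨A, Δ′A⟩` with `Δ′ = 0` (no `Im U(∂p)` at a flat background), combined with «Δ = ∂*∂ + ∂∂*».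
[cite: Balaban1984PropagatorsI, (1.21) p.21; Balaban1985BackgroundPropagators, (3.10) p.392] -/
theorem action_identity_121_Tw (c : ℂ) (ω : Fin d → ℂ) (A : Tor N × Fin d → ℂ) :
    ((((1 / 2 : ℝ) * ∑ x, ∑ μ, ∑ ν, ‖FsTw N c ω A μ ν x‖ ^ 2 : ℝ)) : ℂ)
      = (∑ μ, star (comp N A μ) ⬝ᵥ (LapSTw N c ω *ᵥ comp N A μ))
        - star (divSTw N c ω A) ⬝ᵥ divSTw N c ω A := by
  rw [half_sum_FsTw_sq_eq, crossTw_eq_nsq_divSTw, sum_sq_pdTw_eq_sum_form_gradTw, star_dotProduct_self]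
  simp_rw [form_gradTw_eq_form_LapSTw]
  rfl

/-- **the twisted (1.21) as a quadratic form on vector fields**: `½ Σ_{x,μ,ν}|(DA)_{μν}(x)|² =
⟨A, (Σ_ν(∇^ω_ν)^*∇^ω_ν − ∂^ω(∂^ω)^*) A⟩`. [cite: Balaban1984PropagatorsI, (1.21) p.21; Balaban1985BackgroundPropagators, (3.10) p.392] -/
theorem form_curlTw_eq (c : ℂ) (ω : Fin d → ℂ) (A : Tor N × Fin d → ℂ) :
    ((((1 / 2 : ℝ) * ∑ x, ∑ μ, ∑ ν, ‖FsTw N c ω A μ ν x‖ ^ 2 : ℝ)) : ℂ)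
      = star A ⬝ᵥ ((LapVTw N c ω - GradOpTw N c ω * (GradOpTw N c ω)ᴴ) *ᵥ A) := by
  rw [action_identity_121_Tw, Matrix.sub_mulVec, dotProduct_sub, form_LapVTw, form_GradGradHTw]

/-- `Σ_ν(∇^ω_ν)^*∇^ω_ν − ∂^ω(∂^ω)^* ≥ 0` as a quadratic form (it is `½ Σ|(DA)_{μν}|² = ⟨DA, DA⟩` of (3.10)).
[cite: Balaban1985BackgroundPropagators, (3.10) p.392; Balaban1984PropagatorsI, (1.21) p.21] -/
theorem form_curlTw_nonneg (c : ℂ) (ω : Fin d → ℂ) (A : Tor N × Fin d → ℂ) :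
    0 ≤ (star A ⬝ᵥ ((LapVTw N c ω - GradOpTw N c ω * (GradOpTw N c ω)ᴴ) *ᵥ A)).re := by
  rw [← form_curlTw_eq, Complex.ofReal_re]
  refine mul_nonneg (by norm_num) ?_
  exact Finset.sum_nonneg fun x _ => Finset.sum_nonneg fun μ _ =>
    Finset.sum_nonneg fun ν _ => by positivity

/-- the covariant `D` from vector functions to plaquette functions ([B9] (3.4)), indexed by sites and ORDERED pairs
`(μ, ν)` (the twin of `B5Action121.CurlOp`). [cite: Balaban1985BackgroundPropagators, (3.4) p.391] -/
def CurlOpTw (c : ℂ) (ω : Fin d → ℂ) : Matrix (Tor N × (Fin d × Fin d)) (Tor N × Fin d) ℂ :=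
  fun i j => (if j.2 = i.2.2 then sdiffTw N c ω i.2.1 i.1 j.1 else 0)
    - (if j.2 = i.2.1 then sdiffTw N c ω i.2.2 i.1 j.1 else 0)

omit hN in
/-- RECOVERY: `CurlOpTw … 1 = CurlOp`. [cite: Balaban1984PropagatorsI, (1.2) p.18] -/
theorem CurlOpTw_one (c : ℂ) : CurlOpTw N c 1 = CurlOp N c := by
  ext i j
  simp only [CurlOpTw, CurlOp, sdiffTw_one]

/-- `(D A)(x, (μ, ν)) = (DA)_{μν}(x)`. [cite: Balaban1985BackgroundPropagators, (3.4) p.391] -/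
theorem CurlOpTw_mulVec (c : ℂ) (ω : Fin d → ℂ) (A : Tor N × Fin d → ℂ) (x : Tor N) (μ ν : Fin d) :
    (CurlOpTw N c ω *ᵥ A) (x, (μ, ν)) = FsTw N c ω A μ ν x := by
  simp only [Matrix.mulVec, dotProduct, CurlOpTw, FsTw, pdTw, comp, sub_mul, Finset.sum_sub_distrib,
    Fintype.sum_prod_type, ite_mul, zero_mul, Finset.sum_ite_eq', Finset.mem_univ, if_true]

/-- `⟨A, (D)ᴴD A⟩ = Σ_{x,μ,ν} |(DA)_{μν}(x)|²` for the ordered-pair `D = CurlOpTw` (twice the `⟨DA, DA⟩` of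
(3.10), which sums over plaquettes `μ < ν`). [cite: Balaban1985BackgroundPropagators, (3.4) p.391, (3.10) p.392] -/
theorem form_CurlOpTw (c : ℂ) (ω : Fin d → ℂ) (A : Tor N × Fin d → ℂ) :
    star A ⬝ᵥ (((CurlOpTw N c ω)ᴴ * CurlOpTw N c ω) *ᵥ A)
      = ((∑ x, ∑ μ, ∑ ν, ‖FsTw N c ω A μ ν x‖ ^ 2 : ℝ) : ℂ) := by
  rw [form_gram_rect, star_dotProduct_self, nsq, Fintype.sum_prod_type]
  push_cast
  refine Finset.sum_congr rfl fun x _ => ?_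
  rw [Fintype.sum_prod_type]
  refine Finset.sum_congr rfl fun μ _ => Finset.sum_congr rfl fun ν _ => ?_
  rw [CurlOpTw_mulVec]

/-- **«Δ = ∂*∂ + ∂∂*» AT A CONSTANT ABELIAN BACKGROUND, operator form**: `(CurlOpTw)ᴴ CurlOpTw =
2·(Σ_ν(∇^ω_ν)^*∇^ω_ν − ∂^ω(∂^ω)ᴴ)` (ordered pairs give `2 D^*D`, the `½` of (1.21)); [B9] (3.10) with `Δ′ = 0`.
[cite: Balaban1984PropagatorsI, (1.21) p.21, (1.69) p.29; Balaban1985BackgroundPropagators, (3.10) p.392] -/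
theorem curlTw_adjoint_curlTw (c : ℂ) (ω : Fin d → ℂ) :
    (CurlOpTw N c ω)ᴴ * CurlOpTw N c ω
      = (2 : ℂ) • (LapVTw N c ω - GradOpTw N c ω * (GradOpTw N c ω)ᴴ) := by
  refine ext_of_form_eq fun A => ?_
  rw [form_CurlOpTw, Matrix.smul_mulVec, dotProduct_smul, ← form_curlTw_eq, smul_eq_mul]
  push_cast
  ring

variable (n : ℕ) [NeZero n] (M : Fin d → ℕ) [hM : ∀ μ, NeZero (M μ)]

/-- the twin of `B5Prop11Lower.Lap`: `Σ_ν (∇^ω_ν)^*∇^ω_ν` on vector functions on `T_η = Tor (fine n M)`,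
`η = 1/n`. [cite: Balaban1985BackgroundPropagators, (3.23) p.394; Balaban1984PropagatorsI, (1.21) p.21, (1.90) p.33] -/
def LapTw (ω : Fin d → ℂ) : Matrix (Tor (fine n M) × Fin d) (Tor (fine n M) × Fin d) ℂ :=
  ∑ ν, (fdiffTw (fine n M) (n : ℂ) ω ν)ᴴ * fdiffTw (fine n M) (n : ℂ) ω ν

/-- RECOVERY: `LapTw n M 1 = B5Prop11Lower.Lap n M`. [cite: Balaban1984PropagatorsI, (1.21) p.21, (1.90) p.33] -/
theorem LapTw_one : LapTw n M 1 = Lap n M := by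
  simp only [LapTw, Lap, fdiffTw_one]

/-- `LapTw` is `LapVTw` on the fine torus (`c = η⁻¹ = n`). [cite: Balaban1985BackgroundPropagators, (3.23) p.394] -/
theorem LapTw_eq_LapVTw (ω : Fin d → ℂ) : LapTw n M ω = LapVTw (fine n M) (n : ℂ) ω := rfl

end Vector

/-! ## §3 The twisted block averages `Q′^ω_k` ((3.19)) and `Q^ω_k` ((1.18) with transports); the twisted (1.20) -/

section Averages

variable {d : ℕ} (n : ℕ) [NeZero n] (M : Fin d → ℕ) [hM : ∀ μ, NeZero (M μ)]

/-- the transport phase from the block's base corner `ny` to `x = ny + j`: `R(U(Γ_{y,x})) = ω^j := Π_ν ω_ν^{j_ν}` at a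
constant abelian background (path-independent inside the block: flatness). [cite: Balaban1985BackgroundPropagators, (3.19) p.393] -/
def twPow (ω : Fin d → ℂ) (j : Fin d → Fin n) : ℂ := ∏ ν, ω ν ^ (j ν : ℕ)

omit [NeZero n] in
/-- RECOVERY: `1^j = 1` (no transport at `U = 1`: (3.19) is (1.20)'s `Q′_k`). [cite: Balaban1985BackgroundPropagators, (3.19) p.393] -/
theorem twPow_one (j : Fin d → Fin n) : twPow n 1 j = 1 := by
  simp only [twPow, Pi.one_apply, one_pow, Finset.prod_const_one]

/-- «A([x, x(b)])» with transports: `Σ_{t<n} ω_μ^t A_μ(x + tηe_μ)` — the straight contour of `n` fine bonds from `x`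
to `x + e_μ`, each bond variable transported back to `x` along the contour (phase `ω_μ^t` after `t` steps).
[cite: Balaban1984PropagatorsI, (1.18) p.20; Balaban1985BackgroundPropagators, (3.13)-(3.15) p.393] -/
def lineSumTw (ω : Fin d → ℂ) (A : Tor (fine n M) × Fin d → ℂ) (x : Tor (fine n M)) (μ : Fin d) : ℂ :=
  ∑ t : Fin n, ω μ ^ (t : ℕ) * A (x + tstep (fine n M) μ t, μ)

omit [NeZero n] hM in
/-- RECOVERY: `lineSumTw 1 = lineSum`. [cite: Balaban1984PropagatorsI, (1.18) p.20] -/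
theorem lineSumTw_one (A : Tor (fine n M) × Fin d → ℂ) (x : Tor (fine n M)) (μ : Fin d) :
    lineSumTw n M 1 A x μ = lineSum n M A x μ := by
  simp only [lineSumTw, lineSum, Pi.one_apply, one_pow, one_mul]

/-- [B9] (3.19) «(Q′(U)λ)(y) = Σ_{x∈B(y)} L^{−d} R(U(Γ_{y,x}))λ(x)» at a constant abelian background, as a matrix
`T₁^{(k)} ← T_η` (`L^k = n`, `x = ny + j`, transport `ω^j`); the twin of `B5Block118.QsOp` ((1.20) `Q′_k`).
[cite: Balaban1985BackgroundPropagators, (3.19) p.393; Balaban1984PropagatorsI, (1.20) p.20] -/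
def QsOpTw (ω : Fin d → ℂ) : Matrix (Tor M) (Tor (fine n M)) ℂ :=
  fun y x => ∑ j : Fin d → Fin n, if x = bpt n M y j then twPow n ω j / (n : ℂ) ^ d else 0

omit [NeZero n] hM in
/-- RECOVERY: `Q′^1_k = Q′_k` (`B5Block118.QsOp`). [cite: Balaban1984PropagatorsI, (1.20) p.20] -/
theorem QsOpTw_one : QsOpTw n M 1 = QsOp n M := by
  ext y x
  simp only [QsOpTw, QsOp, twPow_one, one_div]

/-- `(Q′^ω_k f)(y) = η^d Σ_j ω^j f(ny + j)`. [cite: Balaban1985BackgroundPropagators, (3.19) p.393] -/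
theorem QsOpTw_mulVec (ω : Fin d → ℂ) (f : Tor (fine n M) → ℂ) (y : Tor M) :
    (QsOpTw n M ω *ᵥ f) y = 1 / (n : ℂ) ^ d * ∑ j : Fin d → Fin n, twPow n ω j * f (bpt n M y j) := by
  simp only [Matrix.mulVec, dotProduct, QsOpTw, Finset.sum_mul, ite_mul, zero_mul]
  rw [Finset.sum_comm, Finset.mul_sum]
  refine Finset.sum_congr rfl fun j _ => ?_
  simp only [Finset.sum_ite_eq', Finset.mem_univ, if_true]
  ring

/-- the linear part `Q(U₀)` of the averaging (3.13)–(3.15) at a constant abelian background on a charged sector, in the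
straight-contour reading of (1.18): `(Q^ω_kA)_{⟨y,y+e_μ⟩} = η^{d+1} Σ_{x∈B^k(y)} ω^{x−ny} Σ_{t<n} ω_μ^t A_μ(x + tηe_μ)`,
as a matrix on vector fields; the twin of `B5Block118.QvOp`.
[cite: Balaban1984PropagatorsI, (1.18) p.20; Balaban1985BackgroundPropagators, (3.13)-(3.15) p.393] -/
def QvOpTw (ω : Fin d → ℂ) : Matrix (Tor M × Fin d) (Tor (fine n M) × Fin d) ℂ :=
  fun b i => if i.2 = b.2 then
    ∑ j : Fin d → Fin n, ∑ t : Fin n,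
      (if i.1 = bpt n M b.1 j + tstep (fine n M) b.2 t
        then twPow n ω j * ω b.2 ^ (t : ℕ) / (n : ℂ) ^ (d + 1) else 0)
    else 0

omit [NeZero n] hM in
/-- RECOVERY: `Q^1_k = Q_k` (`B5Block118.QvOp`, (1.18)). [cite: Balaban1984PropagatorsI, (1.18) p.20] -/
theorem QvOpTw_one : QvOpTw n M 1 = QvOp n M := by
  ext b i
  simp only [QvOpTw, QvOp, twPow_one, Pi.one_apply, one_pow, one_mul, one_div]

/-- `(Q^ω_k A)_{⟨y,y+e_μ⟩} = η^{d+1} Σ_j ω^j Σ_{t<n} ω_μ^t A_μ(ny + j + tηe_μ)`.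
[cite: Balaban1984PropagatorsI, (1.18) p.20; Balaban1985BackgroundPropagators, (3.15) p.393] -/
theorem QvOpTw_mulVec (ω : Fin d → ℂ) (A : Tor (fine n M) × Fin d → ℂ) (y : Tor M) (μ : Fin d) :
    (QvOpTw n M ω *ᵥ A) (y, μ)
      = 1 / (n : ℂ) ^ (d + 1) * ∑ j : Fin d → Fin n, twPow n ω j * lineSumTw n M ω A (bpt n M y j) μ := by
  simp only [Matrix.mulVec, dotProduct, QvOpTw, lineSumTw]
  rw [Fintype.sum_prod_type]
  simp only [ite_mul, zero_mul, Finset.sum_ite_eq', Finset.mem_univ, if_true, Finset.sum_mul]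
  rw [Finset.sum_comm, Finset.mul_sum]
  refine Finset.sum_congr rfl fun j _ => ?_
  rw [Finset.sum_comm, Finset.mul_sum, Finset.mul_sum]
  refine Finset.sum_congr rfl fun t _ => ?_
  simp only [Finset.sum_ite_eq', Finset.mem_univ, if_true]
  ring

/-- telescoping with phases: `Σ_{t<m} ω^t (ω g(t+1) − g(t)) = ω^m g(m) − g(0)` — the step behind (1.20) «Q_kA^λ =
Q_kA − ∂Q′_kλ» with transports. [cite: Balaban1984PropagatorsI, (1.20) p.20] -/
theorem sum_fin_telescope_tw (ω : ℂ) (g : ℕ → ℂ) (m : ℕ) :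
    ∑ t : Fin m, ω ^ (t : ℕ) * (ω * g ((t : ℕ) + 1) - g t) = ω ^ m * g m - g 0 := by
  have h : ∀ t : ℕ, ω ^ t * (ω * g (t + 1) - g t) = ω ^ (t + 1) * g (t + 1) - ω ^ t * g t := by
    intro t
    rw [pow_succ]
    ring
  rw [Fin.sum_univ_eq_sum_range (fun t => ω ^ t * (ω * g (t + 1) - g t)) m]
  simp_rw [h]
  rw [Finset.sum_range_sub (fun t => ω ^ t * g t), pow_zero, one_mul]

/-- `∂^ω` telescopes along `[x, x + e_μ]` with the holonomy `ω_μ^n` of the coarse bond: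
`Σ_t ω_μ^t (A − ∂^ωλ)_μ(x + te_μ) = Σ_t ω_μ^t A_μ(x + te_μ) − n(ω_μ^n λ(x + e_μ) − λ(x))`.
[cite: Balaban1984PropagatorsI, (1.20) p.20; Balaban1985BackgroundPropagators, (3.17) p.393] -/
theorem lineSumTw_gaugeTTw (ω : Fin d → ℂ) (A : Tor (fine n M) × Fin d → ℂ) (l : Tor (fine n M) → ℂ)
    (x : Tor (fine n M)) (μ : Fin d) :
    lineSumTw n M ω (gaugeTTw (fine n M) (n : ℂ) ω A l) x μ
      = lineSumTw n M ω A x μ - (n : ℂ) * (ω μ ^ n * l (x + tstep (fine n M) μ n) - l x) := by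
  have h : ∀ t : Fin n,
      ω μ ^ (t : ℕ) * (gaugeTTw (fine n M) (n : ℂ) ω A l) (x + tstep (fine n M) μ t, μ)
        = ω μ ^ (t : ℕ) * A (x + tstep (fine n M) μ t, μ)
          - (n : ℂ) * (ω μ ^ (t : ℕ) * (ω μ * l (x + tstep (fine n M) μ ((t : ℕ) + 1))
              - l (x + tstep (fine n M) μ t))) := by
    intro t
    simp only [gaugeTTw, Pi.sub_apply, GradOpTw_mulVec, sdiffTw_mulVec]
    rw [tstep_succ, ← add_assoc]
    ring
  simp only [lineSumTw, h, Finset.sum_sub_distrib, ← Finset.mul_sum]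
  rw [sum_fin_telescope_tw (ω μ) (fun t => l (x + tstep (fine n M) μ t)) n]
  simp [tstep_zero]

/-- the twisted (1.20): `(Q^ω_k(A − ∂^ωλ))_{⟨y,y+e_μ⟩} = (Q^ω_kA)_{⟨y,y+e_μ⟩} − (ω_μ^n (Q′^ω_kλ)(y + e_μ) −
(Q′^ω_kλ)(y))` («(Q_kA^λ)_b = (Q_kA)_b − (Σ_{x∈B^k(b₊)} η^dλ(x) − Σ_{x∈B^k(b₋)} η^dλ(x))» with transports).
[cite: Balaban1984PropagatorsI, (1.20) p.20; Balaban1985BackgroundPropagators, (3.17)-(3.19) p.393] -/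
theorem QvOpTw_gaugeTTw (ω : Fin d → ℂ) (A : Tor (fine n M) × Fin d → ℂ) (l : Tor (fine n M) → ℂ)
    (y : Tor M) (μ : Fin d) :
    (QvOpTw n M ω *ᵥ gaugeTTw (fine n M) (n : ℂ) ω A l) (y, μ)
      = (QvOpTw n M ω *ᵥ A) (y, μ)
        - (ω μ ^ n * (QsOpTw n M ω *ᵥ l) (y + unitVec M μ) - (QsOpTw n M ω *ᵥ l) y) := by
  have hnc : (n : ℂ) ≠ 0 := by exact_mod_cast NeZero.ne n
  have e1 : (∑ j : Fin d → Fin n, twPow n ω j * (lineSumTw n M ω A (bpt n M y j) μ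
        - (n : ℂ) * (ω μ ^ n * l (bpt n M (y + unitVec M μ) j) - l (bpt n M y j))))
      = (∑ j : Fin d → Fin n, twPow n ω j * lineSumTw n M ω A (bpt n M y j) μ)
        - (n : ℂ) * ω μ ^ n * (∑ j : Fin d → Fin n, twPow n ω j * l (bpt n M (y + unitVec M μ) j))
        + (n : ℂ) * ∑ j : Fin d → Fin n, twPow n ω j * l (bpt n M y j) := by
    rw [Finset.mul_sum, Finset.mul_sum, ← Finset.sum_sub_distrib, ← Finset.sum_add_distrib]
    refine Finset.sum_congr rfl fun j _ => ?_
    ring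
  rw [QvOpTw_mulVec, QvOpTw_mulVec, QsOpTw_mulVec, QsOpTw_mulVec]
  simp_rw [lineSumTw_gaugeTTw, bpt_add_tstep]
  rw [e1]
  field_simp
  ring

/-- the twisted (1.20), operator form: `Q^ω_k(A − ∂^ωλ) = Q^ω_kA − ∂^{ω^n}Q′^ω_kλ` with the unit-lattice twisted
gradient of phases `ω_μ^n` (factor `1`) — «Q_kA^λ = Q_kA − ∂Q′_kλ» with transports.
[cite: Balaban1984PropagatorsI, (1.20) p.20; Balaban1985BackgroundPropagators, (3.19) p.393] -/
theorem QvOpTw_gaugeTTw_eq (ω : Fin d → ℂ) (A : Tor (fine n M) × Fin d → ℂ) (l : Tor (fine n M) → ℂ) :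
    QvOpTw n M ω *ᵥ gaugeTTw (fine n M) (n : ℂ) ω A l
      = QvOpTw n M ω *ᵥ A - GradOpTw M 1 (fun μ => ω μ ^ n) *ᵥ (QsOpTw n M ω *ᵥ l) := by
  funext ⟨y, μ⟩
  rw [Pi.sub_apply, GradOpTw_mulVec, sdiffTw_mulVec, one_mul, QvOpTw_gaugeTTw]

end Averages

end

end Literature.MathematicalPhysics.QuantumFieldTheory.Balaban1983to89.B5ToronOperators118
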